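import Literature.AlgebraicGeometry.Resolution.HilbertSamuelGenericConstancyExcellent
import Literature.AlgebraicGeometry.Resolution.HilbertSamuelLowerBound
import Literature.AlgebraicGeometry.Resolution.HilbertSamuelIsolatedSingularities
import Literature.AlgebraicGeometry.Resolution.QuasiExcellentSchemes
import Literature.AlgebraicGeometry.Resolution.ExcellentRingsFieldProofs
import Literature.AlgebraicGeometry.Resolution.ResolutionGlue
import Mathlib.AlgebraicGeometry.Morphisms.Proper
import Mathlib.AlgebraicGeometry.Noetherian
import HarnessLib

/-!
# Glue `ν`-modifications into a `Σ^max`-modification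
# (crux `SigmaMaxModifications`, stmt-ResolutionOfSingularities-18506, line `Sketch`)

Stub `stub_sigmaMaxModification_of_nuModifications` of the lead skeleton: the bookkeeping step
Cossart–Jannsen–Saito, LNM 2270, Def. 6.14 → Def. 6.15 (Rem. 6.24). The class of schemes is:
reduced, separated, locally of finite type and quasi-compact over the field `k`, of dimension
`≤ N`. A `ν`-modification of `Y` is a proper `π : Y' ⟶ Y` with `Y'` in the class, an
isomorphism over every open inside `Y ∖ Y(ν)`, pulling dense opens inside `Y ∖ Y(ν)` back to
dense opens, with `H^N` non-increasing and `ν ∉ Σ_{Y'}`. If every scheme of the class admits a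
`ν`-modification for each maximal `ν ≠ Φ^{(N)}`, then every non-regular scheme `X` of the class
admits a `Σ^max`-modification: proper, source in the class, an isomorphism over every open inside
`X ∖ X_max`, dense preimages of dense opens inside `X ∖ X_max`, `H^N` non-increasing, and no
maximal value of `Σ_X` survives.

Proof: `Σ_X` is finite (`Scheme.finite_hsValues_of_isExcellent`, schemes locally of finite type
over a field being excellent, `Stacks07QW_field_holds`), so the set `Σ_X^max` of maximal values is
finite; no maximal value is `Φ^{(N)}` since `Φ^{(N)}` is the least value and `X` is not regular
(`Scheme.isRegular_iff_hsValues_subset`). Kill the maximal values one at a time by induction over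
finite subsets of `Σ_X^max`: along an `H`-non-increasing map a maximal value of `Σ_X` which is
still a value stays maximal, a point carrying a maximal value of `Σ_X` lies over the stratum of
that value, and a killed maximal value never reappears; isomorphisms over opens
(`morphismRestrict_comp`) and dense preimages compose.
-/

set_option linter.dupNamespace false -- mandated namespace of this single-conjunct summit

noncomputable section

open CategoryTheory AlgebraicGeometry TopologicalSpace
open Literature.AlgebraicGeometry.Resolution Literature.RingTheory.HilbertSamuel

namespace Summit.ResolutionOfSingularities.ResolutionOfSingularities.Theorems.SigmaMaxModifications.Sketch

/-- Along an `H^N`-non-increasing map `π : X' ⟶ X`, a point of `X'` whose value is `≥` a maximal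
value `μ` of `Σ_X` has value exactly `μ`, and so does its image (CJS Rem. 6.24 bookkeeping).
[cite: CossartJannsenSaito2020, Rem. 6.24] -/
private theorem hsFun_eq_of_maximal_of_le {X X' : Scheme.{0}} {N : ℕ} (π : X' ⟶ X)
    (hmono : ∀ x' : X', Scheme.hsFun X' N x' ≤ Scheme.hsFun X N (π.base x')) {μ : ℕ → ℕ}
    (hμ : Maximal (· ∈ Scheme.hsValues X N) μ) {x' : X'} (hle : μ ≤ Scheme.hsFun X' N x') :
    Scheme.hsFun X' N x' = μ ∧ Scheme.hsFun X N (π.base x') = μ := by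
  have h1 : μ ≤ Scheme.hsFun X N (π.base x') := hle.trans (hmono x')
  have h2 : Scheme.hsFun X N (π.base x') ≤ μ := hμ.2 ⟨π.base x', rfl⟩ h1
  exact ⟨le_antisymm ((hmono x').trans h2) hle, le_antisymm h2 h1⟩

/-- **The induction** (CJS Def. 6.14 → Def. 6.15): for a finite set `S` of maximal values of
`Σ_X`, none of which is `Φ^{(N)}`, the `ν`-modifications compose to a proper `π : X' ⟶ X` with
`X'` in the class, an isomorphism over every open inside `X ∖ ⋃_{ν ∈ S} X(ν)`, dense preimages of
dense opens inside that complement, `H^N` non-increasing, and no `ν ∈ S` a value of `Σ_{X'}`.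
[cite: CossartJannsenSaito2020, Def. 6.15, Rem. 6.24] -/
private theorem exists_modification_killing_finite {k : Type} [Field k] {N : ℕ}
    (hmod : ∀ (Y : Scheme.{0}) (g : Y ⟶ Spec (.of k)), IsSeparated g → LocallyOfFiniteType g →
      QuasiCompact g → IsReduced Y → topologicalKrullDim Y ≤ (N : WithBot ℕ∞) →
      ∀ ν : ℕ → ℕ, Maximal (· ∈ Scheme.hsValues Y N) ν → ν ≠ iterPSum N Phi →
        ∃ (Y' : Scheme.{0}) (π : Y' ⟶ Y), IsProper π ∧ IsReduced Y' ∧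
          topologicalKrullDim Y' ≤ (N : WithBot ℕ∞) ∧
          (∀ U : Y.Opens, (U : Set Y) ⊆ (Scheme.hsStratum Y N ν)ᶜ → IsIso (π ∣_ U)) ∧
          (∀ U : Y.Opens, Dense (U : Set Y) → (U : Set Y) ⊆ (Scheme.hsStratum Y N ν)ᶜ →
            Dense ((π ⁻¹ᵁ U : Y'.Opens) : Set Y')) ∧
          (∀ y' : Y', Scheme.hsFun Y' N y' ≤ Scheme.hsFun Y N (π.base y')) ∧
          ν ∉ Scheme.hsValues Y' N)
    {X : Scheme.{0}} (f : X ⟶ Spec (.of k)) [IsSeparated f] [LocallyOfFiniteType f]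
    [QuasiCompact f] [IsReduced X] (hdim : topologicalKrullDim X ≤ (N : WithBot ℕ∞))
    (hΦ : ∀ ν : ℕ → ℕ, Maximal (· ∈ Scheme.hsValues X N) ν → ν ≠ iterPSum N Phi)
    (S : Set (ℕ → ℕ)) (hS : S.Finite)
    (hSM : ∀ ν ∈ S, Maximal (· ∈ Scheme.hsValues X N) ν) :
    ∃ (X' : Scheme.{0}) (π : X' ⟶ X), IsProper π ∧ IsReduced X' ∧
      topologicalKrullDim X' ≤ (N : WithBot ℕ∞) ∧
      (∀ U : X.Opens, (U : Set X) ⊆ (⋃ ν ∈ S, Scheme.hsStratum X N ν)ᶜ → IsIso (π ∣_ U)) ∧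
      (∀ U : X.Opens, Dense (U : Set X) → (U : Set X) ⊆ (⋃ ν ∈ S, Scheme.hsStratum X N ν)ᶜ →
        Dense ((π ⁻¹ᵁ U : X'.Opens) : Set X')) ∧
      (∀ x' : X', Scheme.hsFun X' N x' ≤ Scheme.hsFun X N (π.base x')) ∧
      ∀ ν ∈ S, ν ∉ Scheme.hsValues X' N := by
  induction S, hS using Set.Finite.induction_on with
  | empty =>
    refine ⟨X, 𝟙 X, inferInstance, ‹_›, hdim, fun U _ => ?_, fun U hU _ => hU, fun _ => le_rfl,
      fun ν hν => absurd hν (Set.notMem_empty ν)⟩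
    show IsIso (𝟙 X ∣_ U)
    infer_instance
  | @insert μ S _ _ ih =>
    obtain ⟨XS, πS, hπS, hredS, hdimS, hisoS, hdenseS, hmonoS, hkillS⟩ :=
      ih fun ν hν => hSM ν (Set.mem_insert_of_mem μ hν)
    have hμM : Maximal (· ∈ Scheme.hsValues X N) μ := hSM μ (Set.mem_insert μ S)
    -- the complement of the bigger union lies in the complement of the smaller one
    have hsub : (⋃ ν ∈ insert μ S, Scheme.hsStratum X N ν)ᶜ ⊆
        (⋃ ν ∈ S, Scheme.hsStratum X N ν)ᶜ :=
      Set.compl_subset_compl.mpr (Set.biUnion_subset_biUnion_left (Set.subset_insert μ S))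
    by_cases hμS : μ ∈ Scheme.hsValues XS N
    · -- `μ` is still a value on `X_S`: it is maximal there, and we kill it with `hmod`
      have hμmax : Maximal (· ∈ Scheme.hsValues XS N) μ := by
        refine ⟨hμS, fun lam hlam hμlam => ?_⟩
        obtain ⟨x', rfl⟩ := hlam
        exact (hsFun_eq_of_maximal_of_le πS hmonoS hμM hμlam).1.le
      haveI := hπS
      haveI := hredS
      obtain ⟨X', ρ, hρ, hred', hdim', hisoρ, hdenseρ, hmonoρ, hkillρ⟩ :=
        hmod XS (πS ≫ f) inferInstance inferInstance inferInstance hredS hdimS μ hμmax (hΦ μ hμM)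
      haveI := hρ
      -- over an open missing `⋃_{ν ∈ insert μ S} X(ν)`, the preimage under `π_S` misses `X_S(μ)`
      have hpre : ∀ U : X.Opens, (U : Set X) ⊆ (⋃ ν ∈ insert μ S, Scheme.hsStratum X N ν)ᶜ →
          ((πS ⁻¹ᵁ U : XS.Opens) : Set XS) ⊆ (Scheme.hsStratum XS N μ)ᶜ := by
        intro U hU x' hx' hx'μ
        refine hU hx' (Set.mem_biUnion (Set.mem_insert μ S) ?_)
        rw [Scheme.mem_hsStratum_iff] at hx'μ ⊢
        exact (hsFun_eq_of_maximal_of_le πS hmonoS hμM hx'μ.symm.le).2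
      refine ⟨X', ρ ≫ πS, inferInstance, hred', hdim', fun U hU => ?_, fun U hU hU' => ?_,
        fun x'' => ?_, fun ν hν => ?_⟩
      · -- isomorphisms over opens compose
        haveI h1 : IsIso (πS ∣_ U) := hisoS U (hU.trans hsub)
        haveI h2 : IsIso (ρ ∣_ πS ⁻¹ᵁ U) := hisoρ _ (hpre U hU)
        rw [morphismRestrict_comp]
        exact IsIso.comp_isIso (f := ρ ∣_ πS ⁻¹ᵁ U) (h := πS ∣_ U)
      · -- dense preimages compose
        exact hdenseρ (πS ⁻¹ᵁ U) (hdenseS U hU (hU'.trans hsub)) (hpre U hU')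
      · -- `H^N` non-increasing along the composite
        show Scheme.hsFun X' N x'' ≤ Scheme.hsFun X N (πS.base (ρ.base x''))
        exact (hmonoρ x'').trans (hmonoS (ρ.base x''))
      · -- no value of `insert μ S` survives
        rcases Set.mem_insert_iff.mp hν with rfl | hνS
        · exact hkillρ
        · rintro ⟨x'', hx''⟩
          have hνM : Maximal (· ∈ Scheme.hsValues X N) ν := hSM ν hν
          have h1 : ν ≤ Scheme.hsFun XS N (ρ.base x'') := hx''.symm.le.trans (hmonoρ x'')
          exact hkillS ν hνS ⟨ρ.base x'', (hsFun_eq_of_maximal_of_le πS hmonoS hνM h1).1⟩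
    · -- `μ` is already gone on `X_S`: keep `π_S`
      refine ⟨XS, πS, hπS, hredS, hdimS, fun U hU => hisoS U (hU.trans hsub),
        fun U hU hU' => hdenseS U hU (hU'.trans hsub), hmonoS, fun ν hν => ?_⟩
      rcases Set.mem_insert_iff.mp hν with rfl | hνS
      · exact hμS
      · exact hkillS ν hνS

/-- **Glue (CJS Def. 6.14 → Def. 6.15 / Rem. 6.24): `ν`-modifications for every maximal
`ν ≠ Φ^{(N)}` on every scheme of the class give a `Σ^max`-modification of every non-regular scheme
of the class.** The class: reduced, separated, locally of finite type and quasi-compact over the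
field `k`, of dimension `≤ N`. A `ν`-modification of `Y` is a proper `π : Y' ⟶ Y` with `Y'` in the
class, an isomorphism over every open inside `Y ∖ Y(ν)`, pulling dense opens inside `Y ∖ Y(ν)`
back to dense opens, with `H^N` non-increasing and `ν ∉ Σ_{Y'}`. Proof: the maximal values of
`Σ_X` are finitely many (`Scheme.finite_hsValues_of_isExcellent`) and none is `Φ^{(N)}` (the least
value; `X` is not regular, `Scheme.isRegular_iff_hsValues_subset`); kill them one at a time
(`exists_modification_killing_finite`) and rewrite `X_max = ⋃_{ν ∈ Σ_X^max} X(ν)`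
(`Scheme.hsMaxLocus_eq_iUnion`).
[cite: CossartJannsenSaito2020, Def. 6.14, Def. 6.15, Rem. 6.24] -/
theorem stub_sigmaMaxModification_of_nuModifications :
    ∀ (k : Type) [Field k] (N : ℕ),
      (∀ (Y : Scheme.{0}) (g : Y ⟶ Spec (.of k)), IsSeparated g → LocallyOfFiniteType g →
        QuasiCompact g → IsReduced Y → topologicalKrullDim Y ≤ (N : WithBot ℕ∞) →
        ∀ ν : ℕ → ℕ, Maximal (· ∈ Scheme.hsValues Y N) ν → ν ≠ iterPSum N Phi →
          ∃ (Y' : Scheme.{0}) (π : Y' ⟶ Y), IsProper π ∧ IsReduced Y' ∧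
            topologicalKrullDim Y' ≤ (N : WithBot ℕ∞) ∧
            (∀ U : Y.Opens, (U : Set Y) ⊆ (Scheme.hsStratum Y N ν)ᶜ → IsIso (π ∣_ U)) ∧
            (∀ U : Y.Opens, Dense (U : Set Y) → (U : Set Y) ⊆ (Scheme.hsStratum Y N ν)ᶜ →
              Dense ((π ⁻¹ᵁ U : Y'.Opens) : Set Y')) ∧
            (∀ y' : Y', Scheme.hsFun Y' N y' ≤ Scheme.hsFun Y N (π.base y')) ∧
            ν ∉ Scheme.hsValues Y' N) →
      ∀ (X : Scheme.{0}) (f : X ⟶ Spec (.of k)), IsSeparated f → LocallyOfFiniteType f →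
        QuasiCompact f → IsReduced X → ¬ Scheme.IsRegular X →
        topologicalKrullDim X ≤ (N : WithBot ℕ∞) →
        ∃ (X' : Scheme.{0}) (π : X' ⟶ X), IsProper π ∧ IsReduced X' ∧
          topologicalKrullDim X' ≤ (N : WithBot ℕ∞) ∧
          (∀ U : X.Opens, (U : Set X) ⊆ (Scheme.hsMaxLocus X N)ᶜ → IsIso (π ∣_ U)) ∧
          (∀ U : X.Opens, Dense (U : Set X) → (U : Set X) ⊆ (Scheme.hsMaxLocus X N)ᶜ →
            Dense ((π ⁻¹ᵁ U : X'.Opens) : Set X')) ∧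
          (∀ x' : X', Scheme.hsFun X' N x' ≤ Scheme.hsFun X N (π.base x')) ∧
          ∀ ν : ℕ → ℕ, Maximal (· ∈ Scheme.hsValues X N) ν → ν ∉ Scheme.hsValues X' N := by
  intro k _ N hmod X f hsep hft hqc hred hreg hdim
  haveI := hsep
  haveI := hft
  haveI := hqc
  haveI := hred
  haveI : IsLocallyNoetherian X := LocallyOfFiniteType.isLocallyNoetherian f
  haveI : IsNoetherian X := Scheme.isNoetherian_of_finiteType_over_field f
  have hexc : Scheme.IsExcellent X :=
    Scheme.isExcellent_of_locallyOfFiniteType Stacks07QW_field_holds f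
  have hstalk : ∀ x : X, ∃ d : ℕ, ringKrullDim (X.presheaf.stalk x) = d ∧ d ≤ N :=
    fun x => exists_ringKrullDim_stalk_eq_of_topologicalKrullDim_le hdim x
  have hψ : ∀ x : X, Scheme.hsPsi X x ≤ N := fun x => by
    obtain ⟨d, hd, hdN⟩ := hstalk x
    exact (Scheme.hsPsi_le x hd).trans hdN
  have hfin : (Scheme.hsValues X N).Finite := Scheme.finite_hsValues_of_isExcellent hexc N hψ
  have hMfin : {ν | Maximal (· ∈ Scheme.hsValues X N) ν}.Finite := hfin.subset fun ν hν => hν.1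
  -- no maximal value is `Φ^{(N)}`: otherwise `Σ_X ⊆ {Φ^{(N)}}` and `X` would be regular
  have hΦ : ∀ ν : ℕ → ℕ, Maximal (· ∈ Scheme.hsValues X N) ν → ν ≠ iterPSum N Phi := by
    intro ν hν hνΦ
    subst hνΦ
    refine hreg ((Scheme.isRegular_iff_hsValues_subset hstalk).mpr fun μ hμ => ?_)
    have h1 : iterPSum N Phi ≤ μ := Scheme.iterPSum_Phi_le_of_mem_hsValues hμ
    exact le_antisymm (hν.2 hμ h1) h1
  obtain ⟨X', π, hπ, hred', hdim', hiso, hdense, hmono, hkill⟩ :=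
    exists_modification_killing_finite hmod f hdim hΦ {ν | Maximal (· ∈ Scheme.hsValues X N) ν}
      hMfin fun ν hν => hν
  rw [← Scheme.hsMaxLocus_eq_iUnion N] at hiso hdense
  exact ⟨X', π, hπ, hred', hdim', hiso, hdense, hmono, fun ν hν => hkill ν hν⟩

end Summit.ResolutionOfSingularities.ResolutionOfSingularities.Theorems.SigmaMaxModifications.Sketch

end
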